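import Literature.Computability.AlgebraicComplexity.NewtonPolygonTau
import Summits.ValiantsHypothesis.ValiantsHypothesis.Theses.NewtonUnitEquations
import HarnessLib

/-!
# Open-question harvest g11 (grey literature 2017/2025 on `fg + 1`), typed — val-idea-37 g11
# on crux `TwoProducts` (stmt-ValiantsHypothesis-5906)

Sources (all absent from the 5906 board before this file; locators in the companion memo
`Cruxes/TwoProducts/OQH-fg1-grey-val-idea-37-g11.md`):
* P. Koiran, *The fg + 1 problem for Newton polygons*, CALAMAR seminar slides, Lyon, April 2025
  (89 pp; joint with Portier, Tavenas, Thomassé, Aufort, Karthik C.S.) [corpus:paper:url-2ed53f409f16]: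
  p54 «Theorem: if Mon(f) and Mon(g) are in convex position, |Newt(fg+1)| is of linear size;
  extension to Mon(f) or Mon(g) nonconvex» (unpublished); p55 open problems, among them
  «How to take better care of cancellations? Suggestion by Stéphan Thomassé: work with
  f, g ∈ ℤ₂[X,Y]»; p61 «k = 2 is open. What about Newt(f₁⋯f_m + 1)? … the convexity argument
  cannot take us below t^{m/3}»; p70 «upper bounds 2^{O(m)}(kt)^{O(1)}, or even 2^{(m+log kt)^c},
  c < 2, are enough».
* W. Aufort, M2 internship report (ENS Lyon, dir. Koiran), 2017 [corpus:paper:url-7a13ba6a54f2]: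
  Théorème 13 (p19) «Si Mon(f) est convexe, alors |Newt(fg+1)| est linéaire» (proof: ≤ |P| + 17|Q|,
  P = Mon(f) in convex position, g ARBITRARY, any field); Thm 14 (p19) k onion layers ⇒
  O(k·n log n); Thm 12 (p18) fg + h, h on k consecutive hull vertices ⇒ O(n + k log k);
  Thm 8 (p13) k-th onion layer of P + Q has O(k·n log n) points; §4.1 (p19–20) «structure des
  annulations» tried for P = Q and for two layers «sans résultat».
* B. Grenet, HDR memoir, arXiv:2511.11267 (Nov. 2025), Open problem 10.5 (p109): real roots of
  fg + 1 and «a variant that asks for the number of edges in the Newton polygon … O(t^{4/3}) …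
  the original question remains completely open».

What is typed here (statements + trivial restrictions only; NOTHING below bounds anything, and
`TwoProducts`, `PlanarCellBound`, `ResidualLawV25`, the v25 `closes` are UNMOVED; VP ≠ VNP is NOT
proved):
§1 `TwoProductsOver K` — the crux verbatim over an arbitrary field `K` (the tree's
   `newtonVertexCount` is coefficient-generic); `twoProducts_iff_over_complex : TwoProducts ↔
   TwoProductsOver ℂ` (definitional); `TwoProductsGF2 := TwoProductsOver (ZMod 2)` — THOMASSÉ'S
   ARENA (slides p55) in 5906 currency: cancellation = parity of representation counts; neither
   implies nor is implied by the crux; `prod_sub_prod_eq_add` records that over `ZMod 2` the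
   difference of the two products is their sum.  KPTT's `theorem6` (tree, any field) is the known
   ceiling `O(t^{2m/3})` there too.
§2 `TwoProductsConvexInputs` — the CONVEX-POSITION-INPUTS slice (every support point of every
   factor is a vertex of that factor's Newton polygon; count form as in g9's `ci_iff`), with
   `twoProductsConvexInputs_of_twoProducts`; `AufortKoiranConvexInput` — the grey-literature
   m = 2 one-sided claim (Aufort Thm 13 / slides p54) AS A PROP (never asserted; unpublished);
   `ConvexSummandsCIWeak` — the pure-geometry question behind the slice in weak currency
   (convexly independent subsets of a Minkowski sum of m planar sets in convex position, each of
   size ≤ t, have size ≤ 2^{am}(t+2)^b), which KPTT's Prop. 1 grids (non-convex inputs) do not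
   decide.  The slice is DISJOINT from the board's residual address γ1 (the digit grid
   A_s = {2^a e₁ + 2^b e₂} is not in convex position: (1,1),(2,2),(4,4) are collinear), so it is
   recorded as a placement, not as a rung.
-/

set_option linter.dupNamespace false

namespace Summit.ValiantsHypothesis.ValiantsHypothesis.Cruxes.TwoProducts.HarvestG11

open scoped BigOperators Pointwise
open Literature.Computability.AlgebraicComplexity

noncomputable section

/-! ## §1 The crux over an arbitrary field; Thomassé's `ℤ₂` arena -/

/-- The crux `TwoProducts` with the coefficient field `ℂ` replaced by an arbitrary field `K`
(same currency `2^{am}(t+2)^b`, same vertex count `newtonVertexCount`). [folklore] -/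
def TwoProductsOver (K : Type) [Field K] : Prop :=
  ∃ a b : ℕ, ∀ (m t : ℕ) (f g : Fin m → MvPolynomial (Fin 2) K),
    (∀ j, (f j).support.card ≤ t) → (∀ j, (g j).support.card ≤ t) →
      newtonVertexCount (∏ j, f j - ∏ j, g j) ≤ 2 ^ (a * m) * (t + 2) ^ b

/-- The route's crux is literally the `K = ℂ` instance. [folklore] -/
theorem twoProducts_iff_over_complex :
    Theses.NewtonUnitEquations.TwoProducts ↔ TwoProductsOver ℂ := Iff.rfl

/-- THOMASSÉ'S ARENA (Koiran, CALAMAR slides 2025, p55: «Suggestion by Stéphan Thomassé: work with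
f, g ∈ ℤ₂[X,Y]»), in 5906 currency: the two-products statement over `GF(2)`.  A MODEL, not a rung:
it neither implies nor follows from `TwoProducts`. [cite: paper:url-2ed53f409f16, p55] -/
def TwoProductsGF2 : Prop := TwoProductsOver (ZMod 2)

/-- Over `GF(2)` the difference of the two products is their sum (cancellation = parity of the
number of representations). [folklore] -/
theorem prod_sub_prod_eq_add {m : ℕ} (f g : Fin m → MvPolynomial (Fin 2) (ZMod 2)) :
    (∏ j, f j - ∏ j, g j) = ∏ j, f j + ∏ j, g j := by
  exact CharTwo.sub_eq_add _ _

/-! ## §2 The convex-position-inputs slice and the geometric question behind it -/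

/-- The CONVEX-POSITION-INPUTS slice of the crux: all factor supports in convex position (count
form: every monomial of every factor is a vertex of that factor's Newton polygon). [folklore] -/
def TwoProductsConvexInputs : Prop :=
  ∃ a b : ℕ, ∀ (m t : ℕ) (f g : Fin m → MvPolynomial (Fin 2) ℂ),
    (∀ j, (f j).support.card ≤ t) → (∀ j, (g j).support.card ≤ t) →
      (∀ j, newtonVertexCount (f j) = (f j).support.card) →
        (∀ j, newtonVertexCount (g j) = (g j).support.card) →
          newtonVertexCount (∏ j, f j - ∏ j, g j) ≤ 2 ^ (a * m) * (t + 2) ^ b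

/-- Restriction: the crux implies its convex-position-inputs slice. [folklore] -/
theorem twoProductsConvexInputs_of_twoProducts :
    Theses.NewtonUnitEquations.TwoProducts → TwoProductsConvexInputs := by
  rintro ⟨a, b, hab⟩
  exact ⟨a, b, fun m t f g hf hg _ _ => hab m t f g hf hg⟩

/-- GREY LITERATURE, AS A PROP (never asserted here): Aufort 2017, Théorème 13 (proof bound
`|P| + 17|Q|`) = Koiran CALAMAR slides 2025 p54 «extension to Mon(f) or Mon(g) nonconvex»:
in the printed framework «fg has constant term −1» (slides p27; the other cases are immediate), if the
support of `f` is in convex position then `Newt(f·g + 1)` has at most `|Mon f| + 17·|Mon g|`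
vertices, `g` ARBITRARY, any field.  Unpublished (slides p31: «Improved result (unpublished)»);
recorded for the board's print column only.  (Without the framework hypothesis the bound needs
`+ 1`: `f = g = 0` gives one vertex.)
[cite: paper:url-7a13ba6a54f2, Thm 13; paper:url-2ed53f409f16, p54] -/
def AufortKoiranConvexInput : Prop :=
  ∀ (K : Type) [Field K] (f g : MvPolynomial (Fin 2) K),
    (f * g).coeff 0 = -1 →
      newtonVertexCount f = f.support.card →
        newtonVertexCount (f * g + 1) ≤ f.support.card + 17 * g.support.card

/-- The pure-geometry question behind the slice, weak currency: convexly independent subsets of a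
Minkowski sum of `m` planar point sets IN CONVEX POSITION, each of size `≤ t`, have size
`≤ 2^{am}(t+2)^b`.  Lower bounds: `2^{m/3}` (sums of two-point sets give full grids), `Θ(t log t)`
at `m = 2` (Tiwary 2014 / Skomra–Thomassé 2021, arXiv:1903.11287); KPTT Prop. 1's `t^{m/3}`
uses grids `P_k` (not in convex position) and does not decide it. [folklore] -/
def ConvexSummandsCIWeak : Prop :=
  ∃ a b : ℕ, ∀ (m t : ℕ) (A : Fin m → Finset (Fin 2 → ℝ)),
    (∀ j, (A j).card ≤ t) →
      (∀ j, ((A j : Set (Fin 2 → ℝ))) ⊆ Set.extremePoints ℝ (convexHull ℝ (A j : Set (Fin 2 → ℝ)))) →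
        ∀ S : Finset (Fin 2 → ℝ),
          (S : Set (Fin 2 → ℝ)) ⊆ ∑ j, (A j : Set (Fin 2 → ℝ)) →
            (S : Set (Fin 2 → ℝ)) ⊆ Set.extremePoints ℝ (convexHull ℝ (S : Set (Fin 2 → ℝ))) →
              S.card ≤ 2 ^ (a * m) * (t + 2) ^ b

end

end Summit.ValiantsHypothesis.ValiantsHypothesis.Cruxes.TwoProducts.HarvestG11
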